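import Mathlib
import HarnessLib
import Summits.HubbardSuperconductivity.HubbardSuperconductivity.Theorems.KLProgrammeKLRegimeEngineV8TowerCoreDefsC

/-!
# K3 ENGINE (stmt-HubbardSuperconductivity-20437 `KLRegimeEngineV17F2`), stub (b) v2 (ℓ): the CAPPED atom-free core tower package with the c-slot,
# DEFERRED AT A GEOMETRY SLOT `G` — registrant PRESTAGE for the post-FREEZE G-token motion «AMENDMENT 24 — (c)-OUT» (plan g23 (R237)/(R243):
# `klEngGeo11 ↦ klEngGeo13`, candidate successor `klEngGeo14` for AMENDMENT 24+25 (R257)); cell gate-hubbard-kl, seat gate-hubbard-kl-p1b g16 (20437 v2 registrant lineage)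

WHY.  `…EngineV8TowerCoreDefsC` (D4 of the v8.30 FREEZE text, p640134) defers the capped core package `klTowerCorePkgC9 P R` over
`∃ e, IsTowerPkgC e ∧ e.1 ≤ klEngQ9cCE P R ∧ TowerCoreStepV2 klEngGeo11 P R (klEngQ8 P R) e.1 e.2.1 e.2.2` — the geometry is the FROZEN token `klEngGeo11`
((J5) GEO-JOINT: the public history `HistP klPredsV17F2 L M G …` the tower consumes and the conclusion `EngineFirstMoments L M G …` it returns are keyed at the
image's G token and the history is not downward-monotone in `G`).  A G-token motion of the image (AMENDMENT 24: every `klEngGeo11` site ↦ the successor token, all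
seven rows move, as rev 13-G11 did for `klEngGeo10 ↦ klEngGeo11`) therefore needs the SAME package deferred at the successor token.  This file is that package with
the geometry as an explicit PARAMETER, so that ONE text serves whichever successor the pen names (`klEngGeo13` of `…DefsG13`, `klEngGeo14` of `…DefsG14`, or later):
* §1 **`klTowerCorePkgC9G G P R`** over `∃ e, IsTowerPkgC e ∧ e.1 ≤ klEngQ9cCE P R ∧ TowerCoreStepV2 G P R (klEngQ8 P R) e.1 e.2.1 e.2.2` (default
  `(klTowerCoreCE P R, 1, 1)`, admissible and capped in both branches), projections **`klTowerCoreCEC9G / klTowerCoreUC9G / klTowerCoreCC9G`**, UNCONDITIONAL rows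
  `klTowerCoreCEC9G_le_klEngQ9c_CE`, `klTowerCoreUC9G_pos`, `klTowerCoreCC9G_pos` (the successor c-chain's entry `⊓ klTowerCoreCC9G G P R`, the successor u-chain's entry
  `⊓ klTowerCoreUC9G G P R (klEngQ9c P R) cc`), the `choose_spec` rows, the else-branch reader; **`klTowerCorePkgC9G_klEngGeo11`**: at `G := klEngGeo11` the package IS D4's
  `klTowerCorePkgC9 P R` (`rfl`) — nothing of record is redefined;
* §2 **`towerCoreC9G_at_klEngQ9c`** — D4 §4's closer-facing row VERBATIM with `klEngGeo11 ↦ G`: from the capped ∃-statement AT `G` and stub (b)'s binders (history at `G`,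
  (K5′) clause, `FrameOK`, class-#1 exports) the levels bundle at every `1 ≤ j ≤ n` and `EngineFirstMoments L M G P (klEngQ9c P R) … n`.
NOT A MOTION: no token of record moves here; the token `Q := klEngQ9c P R` and the cap `klEngQ9cCE P R` are the frozen ones (a token-#13 motion (α1) re-keys them
separately, cf. the registrant's `…DefsQ9d` prestage).  Definitions with bodies + bookkeeping rows; the producer statement is a HYPOTHESIS slot; nothing about the model
is asserted; nothing asserts (b), (ℓ), any stub of 20437, K3 or superconductivity.
-/

noncomputable section

namespace Summit.HubbardSuperconductivity.HubbardSuperconductivity.Theorems.EngineV8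

set_option linter.dupNamespace false -- summit = problem name (single-conjunct summit), D-0017

open Real Finset Literature.MathematicalPhysics.QuantumLattice Literature.Probability.LatticeModels
open Literature.MathematicalPhysics.QuantumLattice.FermiRG
open Summit.HubbardSuperconductivity.HubbardSuperconductivity.Theorems.KLRegimeSplit
open Summit.HubbardSuperconductivity.HubbardSuperconductivity.Theorems.KLProgrammeLegKernels
open Summit.HubbardSuperconductivity.HubbardSuperconductivity.Theorems.DispersionFlow

/-! ## §1 The capped core-C package deferred at a geometry slot `G` (token `klEngQ9c P R`, cap `klEngQ9cCE P R` frozen) -/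

section CappedG

variable (G : GeoConsts) (P : SplitConsts) (R : RenConsts)

/-- **`klTowerCorePkgC9G G P R`**: SOME admissible `(CE, u, cT)` with `CE ≤ klEngQ9cCE P R` and `TowerCoreStepV2 G P R (klEngQ8 P R) CE u cT`, if one exists,
ELSE `(klTowerCoreCE P R, fun _ _ => 1, 1)` — in BOTH branches admissible and under token #13's `e_T`.  At `G := klEngGeo11` this is D4's `klTowerCorePkgC9 P R`. -/
def klTowerCorePkgC9G : ℝ × (EngConsts → ℝ → ℝ) × ℝ :=
  open scoped Classical in
  if h : ∃ e : ℝ × (EngConsts → ℝ → ℝ) × ℝ, IsTowerPkgC e ∧ e.1 ≤ klEngQ9cCE P R ∧ TowerCoreStepV2 G P R (klEngQ8 P R) e.1 e.2.1 e.2.2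
  then Classical.choose h else (klTowerCoreCE P R, fun _ _ => 1, 1)

/-- **The capped core-C constant at `G`**: `klTowerCoreCEC9G G P R := (klTowerCorePkgC9G G P R).1`. -/
def klTowerCoreCEC9G : ℝ := (klTowerCorePkgC9G G P R).1

/-- **The capped core-C coupling threshold at `G`**: `klTowerCoreUC9G G P R := (klTowerCorePkgC9G G P R).2.1` (successor u-chain entry `⊓ klTowerCoreUC9G G P R (klEngQ9c P R) cc`). -/
def klTowerCoreUC9G : EngConsts → ℝ → ℝ := (klTowerCorePkgC9G G P R).2.1

/-- **The capped core-C regime-constant threshold at `G`**: `klTowerCoreCC9G G P R := (klTowerCorePkgC9G G P R).2.2` (successor c-chain entry `⊓ klTowerCoreCC9G G P R`). -/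
def klTowerCoreCC9G : ℝ := (klTowerCorePkgC9G G P R).2.2

/-- **CONSISTENCY WITH THE FREEZE TEXT**: at the frozen token the G-slotted package IS D4's (`rfl`). -/
theorem klTowerCorePkgC9G_klEngGeo11 : klTowerCorePkgC9G klEngGeo11 P R = klTowerCorePkgC9 P R := rfl

/-- `klTowerCoreCEC9G klEngGeo11 P R = klTowerCoreCEC9 P R` (`rfl`). -/
theorem klTowerCoreCEC9G_klEngGeo11 : klTowerCoreCEC9G klEngGeo11 P R = klTowerCoreCEC9 P R := rfl

/-- `klTowerCoreUC9G klEngGeo11 P R = klTowerCoreUC9 P R` (`rfl`). -/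
theorem klTowerCoreUC9G_klEngGeo11 : klTowerCoreUC9G klEngGeo11 P R = klTowerCoreUC9 P R := rfl

/-- `klTowerCoreCC9G klEngGeo11 P R = klTowerCoreCC9 P R` (`rfl`). -/
theorem klTowerCoreCC9G_klEngGeo11 : klTowerCoreCC9G klEngGeo11 P R = klTowerCoreCC9 P R := rfl

/-- The G-slotted capped package is admissible AND capped (unconditionally): `IsTowerPkgC ∧ constant ≤ klEngQ9cCE P R`. -/
theorem isTowerPkgC_klTowerCorePkgC9G_and_le : IsTowerPkgC (klTowerCorePkgC9G G P R) ∧ (klTowerCorePkgC9G G P R).1 ≤ klEngQ9cCE P R := by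
  classical
  unfold klTowerCorePkgC9G
  split_ifs with h
  · exact ⟨(Classical.choose_spec h).1, (Classical.choose_spec h).2.1⟩
  · exact ⟨⟨klTowerCoreCE_nonneg P R, fun _ _ => one_pos, one_pos⟩, klTowerCoreCE_le_klEngQ9cCE P R⟩

/-- `0 ≤ klTowerCoreCEC9G G P R`. -/
theorem klTowerCoreCEC9G_nonneg : 0 ≤ klTowerCoreCEC9G G P R := (isTowerPkgC_klTowerCorePkgC9G_and_le G P R).1.1

/-- `klTowerCoreCEC9G G P R ≤ klEngQ9cCE P R` (unconditionally). -/
theorem klTowerCoreCEC9G_le_klEngQ9cCE : klTowerCoreCEC9G G P R ≤ klEngQ9cCE P R := (isTowerPkgC_klTowerCorePkgC9G_and_le G P R).2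

/-- **THE CE-JOINT ROW at `G`**: `klTowerCoreCEC9G G P R ≤ (klEngQ9c P R).CE` (unconditionally) — what a stub-(b) closer feeds as `CE ≤ Q.CE` at token #13. -/
theorem klTowerCoreCEC9G_le_klEngQ9c_CE : klTowerCoreCEC9G G P R ≤ (klEngQ9c P R).CE := by
  rw [klEngQ9c_CE_eq]; exact klTowerCoreCEC9G_le_klEngQ9cCE G P R

/-- `0 < klTowerCoreUC9G G P R Q cc` (unconditionally). -/
theorem klTowerCoreUC9G_pos (Q : EngConsts) (cc : ℝ) : 0 < klTowerCoreUC9G G P R Q cc := (isTowerPkgC_klTowerCorePkgC9G_and_le G P R).1.2.1 Q cc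

/-- `0 < klTowerCoreCC9G G P R` (unconditionally). -/
theorem klTowerCoreCC9G_pos : 0 < klTowerCoreCC9G G P R := (isTowerPkgC_klTowerCorePkgC9G_and_le G P R).1.2.2

variable {G P R}

/-- The V2 core AT `G` holds for the G-slotted capped package as soon as some admissible CAPPED witness exists (`choose_spec`). -/
theorem towerCoreStepV2_klTowerCoreC9G_of_exists
    (h : ∃ e : ℝ × (EngConsts → ℝ → ℝ) × ℝ, IsTowerPkgC e ∧ e.1 ≤ klEngQ9cCE P R ∧ TowerCoreStepV2 G P R (klEngQ8 P R) e.1 e.2.1 e.2.2) :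
    TowerCoreStepV2 G P R (klEngQ8 P R) (klTowerCoreCEC9G G P R) (klTowerCoreUC9G G P R) (klTowerCoreCC9G G P R) := by
  classical
  have hpkg : klTowerCorePkgC9G G P R = Classical.choose h := by
    unfold klTowerCorePkgC9G
    rw [dif_pos h]
  unfold klTowerCoreCEC9G klTowerCoreUC9G klTowerCoreCC9G
  rw [hpkg]
  exact (Classical.choose_spec h).2.2

/-- Packaging an explicit CAPPED witness `(CE, u, cT)` at `G`, `CE ≤ klEngQ9cCE P R` (e.g. any `CE ≤ (klEngQ8 P R).CE`, via `klEngQ8_CE_le_klEngQ9cCE`). -/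
theorem towerCoreStepV2_klTowerCoreC9G_of {CE : ℝ} {u : EngConsts → ℝ → ℝ} {cT : ℝ} (hCE : 0 ≤ CE) (hcap : CE ≤ klEngQ9cCE P R)
    (hu : ∀ Q cc, 0 < u Q cc) (hcT : 0 < cT) (hs : TowerCoreStepV2 G P R (klEngQ8 P R) CE u cT) :
    TowerCoreStepV2 G P R (klEngQ8 P R) (klTowerCoreCEC9G G P R) (klTowerCoreUC9G G P R) (klTowerCoreCC9G G P R) :=
  towerCoreStepV2_klTowerCoreC9G_of_exists ⟨(CE, u, cT), ⟨hCE, hu, hcT⟩, hcap, hs⟩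

/-- ELSE branch: with no admissible capped witness at `G` the package IS the default. -/
theorem klTowerCorePkgC9G_of_not_exists
    (h : ¬ ∃ e : ℝ × (EngConsts → ℝ → ℝ) × ℝ, IsTowerPkgC e ∧ e.1 ≤ klEngQ9cCE P R ∧ TowerCoreStepV2 G P R (klEngQ8 P R) e.1 e.2.1 e.2.2) :
    klTowerCorePkgC9G G P R = (klTowerCoreCE P R, fun _ _ => 1, 1) := by
  classical
  unfold klTowerCorePkgC9G
  rw [dif_neg h]

end CappedG

/-! ## §2 The closer-facing row at the frozen token `klEngQ9c P R` and the geometry slot `G`, on stub (b)'s own binders (image keyed at `G`) -/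

/-- **THE CE-, GEO- AND OSC-JOINTS CLOSE BY NAME AT ANY `G`.**  From the capped core ∃-statement AT `G` and stub (b)'s binders under a G-keyed image —
`0 < c ≤ klEngC₃6 P R`, `c ≤ klTowerCoreCC9G G P R` (successor c-chain row), `U ≤ klEngU₀10 P R c`, `U ≤ klTowerCoreUC9G G P R (klEngQ9c P R) c` (successor u-chain row),
the v2 doors, `1 ≤ n ≤ n_β + 1`, the regime, the public history AT `G` / `klEngQ9c P R`, the registered (K5′) mean-free clause, `K_n` admissible, the class-#1 exports —
the levels bundle at every `1 ≤ j ≤ n` and `EngineFirstMoments` at `K_n`, AT `G` / `klEngQ9c P R`: stub (b)'s conjuncts 2 (levels `j ≥ 1`) and 3 under the G-keyed image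
(`isRaiseOf_klEngQ9c_klEngQ8`, `klTowerCoreCEC9G_le_klEngQ9c_CE`).  At `G := klEngGeo11` this is D4's `towerCoreC9_at_klEngQ9c` by `rfl` on the package. -/
theorem towerCoreC9G_at_klEngQ9c {G : GeoConsts} {P : SplitConsts} {R : RenConsts}
    (hex : ∃ e : ℝ × (EngConsts → ℝ → ℝ) × ℝ, IsTowerPkgC e ∧ e.1 ≤ klEngQ9cCE P R ∧ TowerCoreStepV2 G P R (klEngQ8 P R) e.1 e.2.1 e.2.2)
    {c μ U β : ℝ} {L M : ℕ} [NeZero L] [NeZero M] {n : ℕ}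
    (hc : 0 < c) (hc36 : c ≤ klEngC₃6 P R) (hcT : c ≤ klTowerCoreCC9G G P R) (hμ : μ ∈ klWindowC) (hU : 0 < U) (hU10 : U ≤ klEngU₀10 P R c)
    (hUu : U ≤ klTowerCoreUC9G G P R (klEngQ9c P R) c) (hβ : klBetaMin ≤ β) (hβc : β ≤ Real.exp (c / U ^ 2))
    (hL : klEngL₄ P R β U ≤ L) (hM : klEngM₃ β U L ≤ M) (hn1 : 1 ≤ n) (hn : n ≤ nScales β + 1) (hreg : IsKLRegime U c (-(n : ℤ)))
    (hhist : HistP klPredsV17F2 L M G P (klEngQ9c P R) R β U μ 0 n)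
    (hosc : ∀ m, 1 ≤ m → m < n → FlowPieceOscAt L M (klReadOscC P R) β U μ m)
    (hfr : FrameOK R U (nScales β) μ (klFlowFrameU L M β U μ n))
    (hlevU : ∀ j ≤ n, LevelsUExportMixedAt L M (klCU2 P R (klEngQ7 P R)) P β U μ j) :
    (∀ j : ℕ, 1 ≤ j → j ≤ n →
      KernelNormsLevels L M P (klEngQ9c P R) β U μ (klFlowFrameU L M β U μ n) j ∧
        KernelNormsWt4 L M (klWtBudget P (klEngQ9c P R) U j) β U μ (klFlowFrameU L M β U μ n) j) ∧
    EngineFirstMoments L M G P (klEngQ9c P R) β U μ (klFlowFrameU L M β U μ n) n := by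
  have h := towerCoreStepV2_klTowerCoreC9G_of_exists hex
  exact ⟨h.1 (klEngQ9c P R) (isRaiseOf_klEngQ9c_klEngQ8 P R) (klTowerCoreCEC9G_le_klEngQ9c_CE G P R) c hc hc36 hcT μ hμ U hU hU10 hUu β hβ hβc
      L M hL hM n hn1 hn hreg hhist hosc hfr hlevU,
    h.2 (klEngQ9c P R) (isRaiseOf_klEngQ9c_klEngQ8 P R) (klTowerCoreCEC9G_le_klEngQ9c_CE G P R) c hc hc36 μ hμ U hU hU10 hUu β hβ hβc
      L M hL hM n hn1 hn hreg hhist hosc hfr hlevU⟩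

end Summit.HubbardSuperconductivity.HubbardSuperconductivity.Theorems.EngineV8

end
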